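import Summits.QuantumFields.BalabanUV.Beta.MultiscaleParametrixTorus
import Summits.QuantumFields.BalabanUV.Beta.MultiscaleParametrixHull
import Summits.QuantumFields.BalabanUV.Beta.MultiscalePartitionProduct
import Summits.QuantumFields.BalabanUV.Beta.MultiscaleRemainderLapTorus

/-!
# Beta / MultiscaleParametrixBoxes — NODE (w4-a′) REDUCED TO THE LAYER PARTITION: the box family `h_{(j,z)} = ψ_j·hSU^{(M·S_j)}_z`
# built from ANY layer partition of unity `ψ` satisfies every DATA hypothesis of `MultiscaleParametrixTorus.parametrix_torus_adapted`,
# so the LEVEL-FREE parametrix holds for it (MODEL; torus `UT N`, covering cube family of `MultiscaleDecay`)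

INPUT (all DATA): the covering disjoint cube family (levels `J`, sides `S_l`), `A = levelOp …` of `MultiscaleDecay` with a cell-sum
coercivity `C > 0` (isometric `Rm`, `T`), a CONSTANT bond weight `c ≡ c₀`, level weights `|ω_l| ≤ ω̄_l` with `|a_l|ω̄_l²S_l^d ≤ a_max/S_l²`;
`M ≥ 1` with `M·S_j ∣ N_i`, `2M·S_j ≤ N_i`; a LAYER PARTITION `ψ : J → UT N → ℝ` with (ψ0) `Σ_j ψ_j² = 1`, `|ψ_j| ≤ 1`; (ψ1)
`|ψ_j(y + e_μ) − ψ_j(y)| ≤ C_ψ¹/(M S_j)`; (ψ2) `|ψ_j(x + e_μ) − 2ψ_j(x) + ψ_j(x − e_μ)| ≤ C_ψ²/(M S_j)²`; (G1) `ψ_j` VANISHES on every family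
cell whose level is not ADJACENT to `j` (`S_j ≤ L·S_l ∧ S_l ≤ L·S_j`), at most `n_adj` levels adjacent to any `j`; (G2) for every ACTIVE
box the family cells meeting the `(M S_j + 1)`-ball round its centre have side `≤ L·S_j`; (G3) at most `ν` box hulls through a site.
CONSTRUCTION: `boxFam ⟨j, z⟩ = ψ_j·hSU N (M S_j) z` on `Σ j, Ctr N (M·S_j)` (`MultiscalePartitionProduct.prodFam` × b05); `boxHull` =
`MultiscaleParametrixHull.cellHull (ctrU z) (M S_j)` for active boxes, `0` otherwise; box scale `S_j`, hull scale `L·S_j`; `boxOsc`.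
OUTPUT: §2 bump data (`Σh² = 1`; `|h| ≤ 1`; support; `|c∂h| ≤ |c₀|(4d + C_ψ¹)/(M S_j)`; `|Δ_c h| ≤ c₀²·d(52 + C_ψ² + 8dC_ψ¹)/(M S_j)²`);
§3 hull clauses; §4 oscillation clauses (pv21 `abs_sub_base_le` on the cube comb for adjacent levels, (G1) otherwise; budget
`≤ 2a_max·(n_adj·d(4d + C_ψ¹)L)/(M S_j²)`); §5 **`parametrix_boxes`**: `ν·C_rem < M`,
`C_rem = remConst d |c₀| a_max C L (4d + C_ψ¹) (d(52 + C_ψ² + 8dC_ψ¹)) (n_adj·d·(4d + C_ψ¹)·L)` ⟹ `1 − R′` unit, `A⁻¹ = G′₀(1 − R′)⁻¹`,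
`‖(1 − R′)⁻¹‖_{ℓ²} ≤ (1 − C_remν/M)⁻¹` — LEVEL-FREE.  Remaining of (w4-a′): `ψ` on a concrete graded family + the counts (G2), (G3)
(unit `b2b-balaban-beta-d4-p2`, GEN 9, MODEL crew; O.2 skeleton v1.5.0 §8.10 DESIGN).

HONEST FRAMING: discharging `BetaPertH` makes Bałaban's UV stability UNCONDITIONAL — NOT the continuum limit, NOT the
Clay problem.  HONEST DEPENDENCY (verbatim): «continuum YM on T⁴ ⇐ BetaPertH ∧ nine spine estimates (0/9 proved);
BetaPertH ⇐ (D1) ∧ (D4) ∧ CAP+tail; G-an2-4 gates asym, D1 and NE2/3/4.»  THIS MODULE DISCHARGES NOTHING of `BetaPertH`,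
asserts NOTHING printed and cites nothing as a fact (ABSOLUTE RULE): [folklore] assembly of this lineage's MODEL theorems and b05's
partition BY NAME; `ψ` and the counts are DATA.  LOCI (shape only): [B5] = `Balaban1984PropagatorsI` (1.118), (1.121) p. 37;
[B6] = `Balaban1984PropagatorsII` (2.1)–(2.2) p. 224, (2.36)–(2.40) pp. 229–230; [B9] = `Balaban1985BackgroundPropagators`
(3.87)–(3.90) pp. 408–409, Thm 3.7.  No class change on row D4 (width 0; D4 DISCHARGE NO DATE); NOT BetaPertH, NOT continuum, NOT Clay.
-/

namespace Summit.QuantumFields.BalabanUV.Beta.MultiscaleParametrixBoxes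

open Finset Function
open Summit.QuantumFields.BalabanUV.Beta.BoxPoincare (Box)
open Summit.QuantumFields.BalabanUV.Beta.MultiscaleCoerciveTorus
open Summit.QuantumFields.BalabanUV.Beta.MultiscaleDecayBudget
open Literature.MathematicalPhysics.QuantumFieldTheory.Balaban1983to89
open B9Thm37Sum B9Thm37Glue B9Thm37GlueTorusInv
open Literature.MathematicalPhysics.QuantumFieldTheory.Balaban1983to89.B9Thm37GluePU (bsrc btgt bsrc_apply btgt_apply
  hSU_eq_zero_of_far hh_torus)
open Literature.MathematicalPhysics.QuantumFieldTheory.Balaban1983to89.B9Thm37GlueTorusCov (tblk torusComb)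
open Literature.MathematicalPhysics.QuantumFieldTheory.Balaban1983to89.B9Thm37GlueTorusCovPoinc (tdepth_le)
open Literature.MathematicalPhysics.QuantumFieldTheory.Balaban1983to89.B9Thm37GlueTorusCovLevels (levelOp levelSum)
open Literature.MathematicalPhysics.QuantumFieldTheory.Balaban1983to89.B9Thm37GlueTorusCovCT (abs_sub_base_le)
open B5TorusCover (UT Ctr ctrU)
open B5SmoothPartition (hSU hSU_lipschitz sum_hSU_sq)
open B5Leibniz121 (up dn up_dn dist_up_le abs_hSU_centred_le)
open Summit.QuantumFields.BalabanUV.Beta.CovariantTowerL2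
open Summit.QuantumFields.BalabanUV.Beta.MultiscaleRemainderLeibniz
open Summit.QuantumFields.BalabanUV.Beta.MultiscaleParametrix
open Summit.QuantumFields.BalabanUV.Beta.MultiscaleParametrixTorus
open Summit.QuantumFields.BalabanUV.Beta.MultiscaleParametrixHull
open Summit.QuantumFields.BalabanUV.Beta.MultiscalePartitionProduct
open Summit.QuantumFields.BalabanUV.Beta.MultiscaleRemainderLapTorus

noncomputable section

variable {d : ℕ} {N : Fin d → ℕ} [∀ i, NeZero (N i)] {Cp J K : Type} [Fintype Cp] [DecidableEq Cp] [Fintype J] [Fintype K]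
  (S : J → ℕ) (hS : ∀ l, 1 ≤ S l) (hdivS : ∀ l i, S l ∣ N i) (lvl : K → J) (zc : (k : K) → Ctr N (S (lvl k)))

/-! ## §1 The box family built from a layer partition -/

/-- MODEL: **the box family** `h_{(j,z)} = ψ_j · hSU N (M·S_j) z` — the layer partition times b05's partition at scale `M·S_j`
([B6] (2.36) SHAPE: cubes of size `2ML^jη` on the layer `Λ_j`). [cite: Balaban1984PropagatorsII, (2.36) p.229; Balaban1984PropagatorsI, (1.118) p.37] -/
def boxFam (M : ℕ) (ψ : J → UT N → ℝ) : (Σ j : J, Ctr N (M * S j)) → UT N → ℝ :=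
  prodFam ψ (fun j (z : Ctr N (M * S j)) => hSU N (M * S j) z)

omit [∀ i, NeZero (N i)] [Fintype J] in
/-- Unfolding. [folklore] -/
theorem boxFam_apply (M : ℕ) (ψ : J → UT N → ℝ) (j : J) (z : Ctr N (M * S j)) (x : UT N) :
    boxFam S M ψ ⟨j, z⟩ x = ψ j x * hSU N (M * S j) z x := rfl

open Classical in
/-- MODEL: **the hull of a box** — for an ACTIVE box (its bump is not identically zero) the union of the family cells meeting the
`(M S_j + 1)`-ball round its centre (`MultiscaleParametrixHull.cellHull`), for an inactive box the empty hull. [cite: Balaban1985BackgroundPropagators, p.408 (Ω₀(□))] -/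
def boxHull (hcover : ∀ x : UT N, ∃ k, ∃ v : Box d (S (lvl k)), cellPt S hS hdivS lvl zc k v = x) (M : ℕ) (ψ : J → UT N → ℝ)
    (p : Σ j : J, Ctr N (M * S j)) (x : UT N) : ℝ :=
  if ∃ y, boxFam S M ψ p y ≠ 0 then cellHull S hS hdivS lvl zc hcover (ctrU N (M * S p.1) p.2) (M * S p.1) x else 0

/-- MODEL bookkeeping: the oscillation budget of box `(j, z)` on level `l` — `d·S_l·(4d + C_ψ¹)/(M S_j)` on ADJACENT levels
(`S_j ≤ L·S_l ∧ S_l ≤ L·S_j`: sides within a factor `L`), `0` on the others. [folklore] -/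
def boxOsc (L M : ℕ) (Cψ₁ : ℝ) (p : Σ j : J, Ctr N (M * S j)) (l : J) : ℝ :=
  if S p.1 ≤ L * S l ∧ S l ≤ L * S p.1 then (d : ℝ) * S l * ((4 * d + Cψ₁) / ((M : ℝ) * S p.1)) else 0

/-! ## §2 The bump data of the box family -/

section Bump

omit [Fintype J] in
/-- `1 ≤ M·S_j`. [folklore] -/
theorem one_le_MS (hS : ∀ l, 1 ≤ S l) {M : ℕ} (hM : 1 ≤ M) (j : J) : 1 ≤ M * S j :=
  Nat.one_le_iff_ne_zero.mpr (Nat.mul_ne_zero (by omega) (by have := hS j; omega))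

omit [∀ i, NeZero (N i)] in
/-- **`Σ_{(j,z)} h_{(j,z)}² = 1`** (ψ0 + b05 `sum_hSU_sq`). [cite: Balaban1984PropagatorsI, (1.118) p.37; Balaban1984PropagatorsII, (2.36) p.229] -/
theorem boxFam_sum_sq (hS : ∀ l, 1 ≤ S l) {M : ℕ} (hM : 1 ≤ M) (hMdiv : ∀ j i, M * S j ∣ N i)
    (h2N : ∀ j i, 2 * (M * S j) ≤ N i) (ψ : J → UT N → ℝ) (hψsq : ∀ x, ∑ j, ψ j x ^ 2 = 1) (x : UT N) :
    ∑ p : Σ j : J, Ctr N (M * S j), boxFam S M ψ p x ^ 2 = 1 :=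
  sum_sq_prodFam ψ _ x (hψsq x) fun j _ => sum_hSU_sq N (one_le_MS S hS hM j) (hMdiv j) (h2N j) x

omit [Fintype J] in
/-- `|h_{(j,z)}| ≤ 1`. [folklore] -/
theorem boxFam_abs_le_one {M : ℕ} (ψ : J → UT N → ℝ) (hψ1 : ∀ j x, |ψ j x| ≤ 1) (p : Σ j : J, Ctr N (M * S j)) (x : UT N) :
    |boxFam S M ψ p x| ≤ 1 :=
  abs_prodFam_le_one ψ _ hψ1 (fun j z y => hh_torus (M * S j) z y) p x

omit [Fintype J] in
/-- **Support**: `h_{(j,z)}(x) ≠ 0 ⟹ dist(x, ctrU z) ≤ M·S_j` (b05 `hSU_eq_zero_of_far`). [folklore] -/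
theorem boxFam_supp (hS : ∀ l, 1 ≤ S l) {M : ℕ} (hM : 1 ≤ M) (ψ : J → UT N → ℝ) (j : J) (z : Ctr N (M * S j)) (x : UT N)
    (hx : boxFam S M ψ ⟨j, z⟩ x ≠ 0) : dist x (ctrU N (M * S j) z) ≤ ((M * S j : ℕ) : ℕ) := by
  by_contra hfar
  exact (prodFam_ne_zero hx).2 (hSU_eq_zero_of_far (one_le_MS S hS hM j) (not_le.mp hfar).le)

omit [Fintype J] in
/-- b05's bump is `4d/(M S_j)`-Lipschitz across every nearest-neighbour bond. [folklore] -/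
theorem hSU_bond_le (hS : ∀ l, 1 ≤ S l) {M : ℕ} (hM : 1 ≤ M) (j : J) (z : Ctr N (M * S j)) (y : UT N) (μ : Fin d) :
    |hSU N (M * S j) z (up y μ) - hSU N (M * S j) z y| ≤ 4 * d / ((M : ℝ) * S j) := by
  have hl := hSU_lipschitz N (one_le_MS S hS hM j) z (up y μ) y
  have hd1 : dist (up y μ) y ≤ 1 := by rw [dist_comm]; exact dist_up_le y μ
  have hMS : ((M * S j : ℕ) : ℝ) = (M : ℝ) * S j := by push_cast; ring
  have h4 : (0 : ℝ) ≤ 4 * d / ((M * S j : ℕ) : ℝ) := by positivity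
  calc |hSU N (M * S j) z (up y μ) - hSU N (M * S j) z y| ≤ 4 * d / ((M * S j : ℕ) : ℝ) * dist (up y μ) y := hl
    _ ≤ 4 * d / ((M * S j : ℕ) : ℝ) * 1 := mul_le_mul_of_nonneg_left hd1 h4
    _ = 4 * d / ((M : ℝ) * S j) := by rw [hMS, mul_one]

omit [Fintype J] in
/-- **Per-bond first differences**: `|h_{(j,z)}(y + e_μ) − h_{(j,z)}(y)| ≤ (4d + C_ψ¹)/(M S_j)` (product rule). [folklore] -/
theorem boxFam_bond_le (hS : ∀ l, 1 ≤ S l) {M : ℕ} (hM : 1 ≤ M) (ψ : J → UT N → ℝ) (hψ1 : ∀ j x, |ψ j x| ≤ 1) {Cψ₁ : ℝ}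
    (hψd : ∀ j y μ, |ψ j (up y μ) - ψ j y| ≤ Cψ₁ / ((M : ℝ) * S j)) (j : J) (z : Ctr N (M * S j)) (b : UT N × Fin d) :
    |boxFam S M ψ ⟨j, z⟩ (btgt b) - boxFam S M ψ ⟨j, z⟩ (bsrc b)| ≤ (4 * d + Cψ₁) / ((M : ℝ) * S j) := by
  obtain ⟨y, μ⟩ := b
  rw [btgt_apply, bsrc_apply]
  have h := abs_prodFam_sub_le ψ (fun j (z : Ctr N (M * S j)) => hSU N (M * S j) z) hψ1
    (fun j z y => hh_torus (M * S j) z y) j z y (up y μ) (hψd j y μ) (hSU_bond_le S hS hM j z y μ)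
  calc |boxFam S M ψ ⟨j, z⟩ (up y μ) - boxFam S M ψ ⟨j, z⟩ y| ≤ 4 * d / ((M : ℝ) * S j) + Cψ₁ / ((M : ℝ) * S j) := h
    _ = (4 * d + Cψ₁) / ((M : ℝ) * S j) := by rw [add_div]

omit [Fintype J] in
/-- **The first datum `|c∂h| ≤ |c₀|·(4d + C_ψ¹)/(M S_j)`** for a constant bond weight. [folklore] -/
theorem boxFam_cdh_le (hS : ∀ l, 1 ≤ S l) {M : ℕ} (hM : 1 ≤ M) (ψ : J → UT N → ℝ) {c : UT N × Fin d → ℝ} {c₀ : ℝ}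
    (hc : ∀ b, c b = c₀) (hψ1 : ∀ j x, |ψ j x| ≤ 1) {Cψ₁ : ℝ} (hψd : ∀ j y μ, |ψ j (up y μ) - ψ j y| ≤ Cψ₁ / ((M : ℝ) * S j))
    (j : J) (z : Ctr N (M * S j)) (b : UT N × Fin d) :
    |c b * (boxFam S M ψ ⟨j, z⟩ (btgt b) - boxFam S M ψ ⟨j, z⟩ (bsrc b))| ≤ |c₀| * (4 * d + Cψ₁) / ((M : ℝ) * S j) := by
  rw [hc, abs_mul, mul_div_assoc]
  exact mul_le_mul_of_nonneg_left (boxFam_bond_le S hS hM ψ hψ1 hψd j z b) (abs_nonneg _)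

omit [Fintype J] in
/-- **Centred second differences** of the box bumps: `≤ (52 + C_ψ² + 8dC_ψ¹)/(M S_j)²` (product rule + b05). [folklore] -/
theorem boxFam_secondDiff_le (hS : ∀ l, 1 ≤ S l) {M : ℕ} (hM : 1 ≤ M) (h2N : ∀ j i, 2 * (M * S j) ≤ N i) (ψ : J → UT N → ℝ)
    (hψ1 : ∀ j x, |ψ j x| ≤ 1) {Cψ₁ Cψ₂ : ℝ} (hψd : ∀ j y μ, |ψ j (up y μ) - ψ j y| ≤ Cψ₁ / ((M : ℝ) * S j))
    (hψdd : ∀ j x μ, |ψ j (up x μ) - 2 * ψ j x + ψ j (dn x μ)| ≤ Cψ₂ / ((M : ℝ) * S j) ^ 2)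
    (j : J) (z : Ctr N (M * S j)) (x : UT N) (μ : Fin d) :
    |boxFam S M ψ ⟨j, z⟩ (up x μ) - 2 * boxFam S M ψ ⟨j, z⟩ x + boxFam S M ψ ⟨j, z⟩ (dn x μ)| ≤
      (52 + Cψ₂ + 8 * d * Cψ₁) / ((M : ℝ) * S j) ^ 2 := by
  have hMS : ((M * S j : ℕ) : ℝ) = (M : ℝ) * S j := by push_cast; ring
  have hF₁m : |ψ j x - ψ j (dn x μ)| ≤ Cψ₁ / ((M : ℝ) * S j) := by
    have h := hψd j (dn x μ) μ
    rwa [up_dn] at h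
  have hG₁ : |hSU N (M * S j) z x - hSU N (M * S j) z (dn x μ)| ≤ 4 * d / ((M : ℝ) * S j) := by
    have h := hSU_bond_le S hS hM j z (dn x μ) μ
    rwa [up_dn] at h
  have hG₂ : |hSU N (M * S j) z (up x μ) - 2 * hSU N (M * S j) z x + hSU N (M * S j) z (dn x μ)| ≤ 52 / ((M : ℝ) * S j) ^ 2 := by
    have h := abs_hSU_centred_le (one_le_MS S hS hM j) (h2N j) z x μ
    rwa [hMS] at h
  have h := abs_prodFam_secondDiff_le ψ (fun j (z : Ctr N (M * S j)) => hSU N (M * S j) z) hψ1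
    (fun j z y => hh_torus (M * S j) z y) j z (dn x μ) x (up x μ) (hψd j x μ) hF₁m hG₁ (hψdd j x μ) hG₂
  refine h.trans (le_of_eq ?_)
  have hM0 : (0 : ℝ) < (M : ℝ) * S j := by
    have := one_le_MS S hS hM j
    rw [← hMS]; exact_mod_cast this
  field_simp
  ring

omit [Fintype J] in
/-- **The second datum `|Δ_c h| ≤ c₀²·d(52 + C_ψ² + 8dC_ψ¹)/(M S_j)²`** for a constant bond weight
(`MultiscaleRemainderLapTorus.abs_lapH_torus_const_le`). [cite: Balaban1985BackgroundPropagators, (3.88) p.409] -/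
theorem boxFam_lap_le (hS : ∀ l, 1 ≤ S l) {M : ℕ} (hM : 1 ≤ M) (h2N : ∀ j i, 2 * (M * S j) ≤ N i) (ψ : J → UT N → ℝ)
    {c : UT N × Fin d → ℝ} {c₀ : ℝ} (hc : ∀ b, c b = c₀) (hψ1 : ∀ j x, |ψ j x| ≤ 1) {Cψ₁ Cψ₂ : ℝ}
    (hψd : ∀ j y μ, |ψ j (up y μ) - ψ j y| ≤ Cψ₁ / ((M : ℝ) * S j))
    (hψdd : ∀ j x μ, |ψ j (up x μ) - 2 * ψ j x + ψ j (dn x μ)| ≤ Cψ₂ / ((M : ℝ) * S j) ^ 2)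
    (j : J) (z : Ctr N (M * S j)) (x : UT N) :
    |lapH bsrc btgt c (boxFam S M ψ ⟨j, z⟩) x| ≤ |c₀| ^ 2 * (d * (52 + Cψ₂ + 8 * d * Cψ₁)) / ((M : ℝ) * S j) ^ 2 := by
  have h := abs_lapH_torus_const_le hc (boxFam S M ψ ⟨j, z⟩) x
    (fun μ => boxFam_secondDiff_le S hS hM h2N ψ hψ1 hψd hψdd j z x μ)
  rw [sq_abs]
  calc |lapH bsrc btgt c (boxFam S M ψ ⟨j, z⟩) x| ≤ c₀ ^ 2 * (d * ((52 + Cψ₂ + 8 * d * Cψ₁) / ((M : ℝ) * S j) ^ 2)) := h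
    _ = c₀ ^ 2 * (d * (52 + Cψ₂ + 8 * d * Cψ₁)) / ((M : ℝ) * S j) ^ 2 := by ring

end Bump

/-! ## §3 The hull clauses of the box family -/

section Hulls

variable (hcover : ∀ x : UT N, ∃ k, ∃ v : Box d (S (lvl k)), cellPt S hS hdivS lvl zc k v = x)
  (M : ℕ) (ψ : J → UT N → ℝ)

omit [Fintype J] [Fintype K] in
/-- The five hull clauses of `parametrix_torus_adapted` for the box family: `hχ`, `hχcell`, `hsite`, `hbond`, and `hH` with
hull scale `L·S_j` under (G2). [cite: Balaban1985BackgroundPropagators, p.408 (Ω₀(□))] -/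
theorem boxHull_clauses (hdisj : ∀ k k' v v', cellPt S hS hdivS lvl zc k v = cellPt S hS hdivS lvl zc k' v' → k = k') (hM : 1 ≤ M) {L : ℕ}
    (hballs : ∀ (j : J) (z : Ctr N (M * S j)), (∃ y, boxFam S M ψ ⟨j, z⟩ y ≠ 0) →
      ∀ k, CellMeets S hS hdivS lvl zc k (ctrU N (M * S j) z) ((M * S j : ℕ) + 1) → S (lvl k) ≤ L * S j) :
    (∀ p x, boxHull S hS hdivS lvl zc hcover M ψ p x = 0 ∨ boxHull S hS hdivS lvl zc hcover M ψ p x = 1) ∧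
      (∀ p k v, boxHull S hS hdivS lvl zc hcover M ψ p (cellPt S hS hdivS lvl zc k v) =
        boxHull S hS hdivS lvl zc hcover M ψ p (ctrU N (S (lvl k)) (zc k))) ∧
      (∀ p x, boxFam S M ψ p x ≠ 0 → boxHull S hS hdivS lvl zc hcover M ψ p x = 1) ∧
      (∀ p b, (boxFam S M ψ p (bsrc b) ≠ 0 ∨ boxFam S M ψ p (btgt b) ≠ 0) →
        boxHull S hS hdivS lvl zc hcover M ψ p (bsrc b) = 1 ∧ boxHull S hS hdivS lvl zc hcover M ψ p (btgt b) = 1) ∧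
      (∀ p x, boxHull S hS hdivS lvl zc hcover M ψ p x = 1 → siteScale S hS hdivS lvl zc hcover x ≤ L * S p.1) := by
  classical
  have hsupp : ∀ (p : Σ j : J, Ctr N (M * S j)) x, boxFam S M ψ p x ≠ 0 → dist x (ctrU N (M * S p.1) p.2) ≤ ((M * S p.1 : ℕ) : ℕ) :=
    fun p x hx => by obtain ⟨j, z⟩ := p; exact boxFam_supp S hS hM ψ j z x hx
  refine ⟨fun p x => ?_, fun p k v => ?_, fun p x hx => ?_, fun p b hb => ?_, fun p x hx => ?_⟩
  · unfold boxHull; split_ifs; exacts [cellHull_zero_or_one S hS hdivS lvl zc hcover _ _ x, Or.inl rfl]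
  · unfold boxHull; split_ifs; exacts [cellHull_cellPt S hS hdivS lvl zc hcover hdisj _ _ k v, rfl]
  · unfold boxHull
    rw [if_pos ⟨x, hx⟩]
    exact hsite_of_supp S hS hdivS lvl zc hcover _ _ (hsupp p) x hx
  · unfold boxHull
    have hact : ∃ y, boxFam S M ψ p y ≠ 0 := hb.elim (fun h => ⟨_, h⟩) fun h => ⟨_, h⟩
    rw [if_pos hact, if_pos hact]
    exact hbond_of_supp S hS hdivS lvl zc hcover _ _ (hsupp p) b hb
  · unfold boxHull at hx
    by_cases hact : ∃ y, boxFam S M ψ p y ≠ 0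
    · rw [if_pos hact] at hx
      obtain ⟨j, z⟩ := p
      exact scale_le_of_cellHull S hS hdivS lvl zc hcover _ _ (hballs j z hact) x hx
    · rw [if_neg hact] at hx
      exact absurd hx (by norm_num)

end Hulls

/-! ## §4 The oscillation clauses -/

section Osc

variable (M : ℕ) (ψ : J → UT N → ℝ) (ω : J → UT N → ℝ)

omit [Fintype J] [Fintype K] in
/-- **The oscillation of a box bump over a weighted level-`l` block**: `≤ boxOsc` — on adjacent levels by the comb-path estimate
(pv21 `abs_sub_base_le` on the cube comb, depth `≤ d(S_l − 1)`), on the other levels `0` because `ψ_j` vanishes on their cells (G1).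
[folklore] -/
theorem boxFam_osc_le [NeZero d] (hM : 1 ≤ M) (hsupp : ∀ l x, ω l (ctrU N (S l) (tblk (hS l) (hdivS l) x)) ≠ 0 →
      ∃ k v, lvl k = l ∧ cellPt S hS hdivS lvl zc k v = x)
    (hψ1 : ∀ j x, |ψ j x| ≤ 1) {Cψ₁ : ℝ} (hCψ₁ : 0 ≤ Cψ₁) (hψd : ∀ j y μ, |ψ j (up y μ) - ψ j y| ≤ Cψ₁ / ((M : ℝ) * S j))
    {L : ℕ} (hψcell : ∀ j k, ¬ (S j ≤ L * S (lvl k) ∧ S (lvl k) ≤ L * S j) → ∀ v, ψ j (cellPt S hS hdivS lvl zc k v) = 0)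
    (p : Σ j : J, Ctr N (M * S j)) (l : J) (x : UT N) (hx : ω l (ctrU N (S l) (tblk (hS l) (hdivS l) x)) ≠ 0) :
    |boxFam S M ψ p x - boxFam S M ψ p (ctrU N (S l) (tblk (hS l) (hdivS l) x))| ≤ boxOsc (d := d) S L M Cψ₁ p l := by
  obtain ⟨j, z⟩ := p
  unfold boxOsc
  by_cases hadj : S j ≤ L * S l ∧ S l ≤ L * S j
  · rw [if_pos hadj]
    have hθ := boxFam_bond_le S hS hM ψ hψ1 hψd j z
    have hpath := abs_sub_base_le (torusComb (hS l) (hdivS l)) (boxFam S M ψ ⟨j, z⟩) hθ x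
    have hdep : ((torusComb (N := N) (hS l) (hdivS l)).depth x : ℝ) ≤ (d : ℝ) * S l := by
      have h1 := tdepth_le (N := N) (hS l) x
      have h2 : d * (S l - 1) ≤ d * S l := Nat.mul_le_mul_left d (Nat.sub_le _ _)
      exact_mod_cast h1.trans h2
    have hθ0 : 0 ≤ (4 * d + Cψ₁) / ((M : ℝ) * S j) := by positivity
    exact hpath.trans (mul_le_mul_of_nonneg_right hdep hθ0)
  · rw [if_neg hadj]
    obtain ⟨k, v, hkl, hkv⟩ := hsupp l x hx
    subst hkl
    have hψx : ψ j x = 0 := by rw [← hkv]; exact hψcell j k hadj v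
    have hcorner : ctrU N (S (lvl k)) (tblk (hS (lvl k)) (hdivS (lvl k)) x) = cellPt S hS hdivS lvl zc k (fun _ => ⟨0, hS (lvl k)⟩) := by
      rw [← hkv, cellPt, tblk_cubePt, cellPt, cubePt_zero]
    have hψc : ψ j (ctrU N (S (lvl k)) (tblk (hS (lvl k)) (hdivS (lvl k)) x)) = 0 := by rw [hcorner]; exact hψcell j k hadj _
    rw [boxFam_apply, boxFam_apply, hψx, hψc, zero_mul, zero_mul, sub_zero, abs_zero]

omit [∀ i, NeZero (N i)] [Fintype K] in
/-- **The oscillation budget of a box**: `Σ_l |a_l|·2ω̄_l²S_l^d·m_{(j,z),l} ≤ 2a_max·(n_adj·d(4d + C_ψ¹)L)/(M S_j²)` under print-size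
weights from above and at most `n_adj` levels adjacent to `j`. [folklore] -/
theorem boxOsc_sum_le (hS : ∀ l, 1 ≤ S l) (hM : 1 ≤ M) (a : J → ℝ) {wmax : J → ℝ} {amax : ℝ} (hamax : 0 ≤ amax)
    (hscaleW : ∀ l, |a l| * (wmax l ^ 2 * ((S l ^ d : ℕ) : ℝ)) ≤ amax / (S l : ℝ) ^ 2) {Cψ₁ : ℝ} (hCψ₁ : 0 ≤ Cψ₁)
    {L : ℕ} (hL : 1 ≤ L) {nadj : ℕ} (hadj : ∀ j, (univ.filter fun l => S j ≤ L * S l ∧ S l ≤ L * S j).card ≤ nadj)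
    (p : Σ j : J, Ctr N (M * S j)) :
    ∑ l, |a l| * (2 * (wmax l ^ 2 * ((S l ^ d : ℕ) : ℝ)) * boxOsc (d := d) S L M Cψ₁ p l) ≤
      2 * amax * ((nadj : ℝ) * d * (4 * d + Cψ₁) * L) / ((M : ℝ) * (S p.1 : ℝ) ^ 2) := by
  classical
  obtain ⟨j, z⟩ := p
  set θ : ℝ := (4 * d + Cψ₁) / ((M : ℝ) * S j) with hθ
  have hSj : (1 : ℝ) ≤ S j := by exact_mod_cast hS j
  have hθ0 : 0 ≤ θ := by positivity
  -- termwise: ≤ (if adj then 2·a_max·d·θ·L/S_j else 0)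
  set B : ℝ := 2 * amax * d * θ * L / S j with hB
  have hB0 : 0 ≤ B := by positivity
  have hterm : ∀ l, |a l| * (2 * (wmax l ^ 2 * ((S l ^ d : ℕ) : ℝ)) * boxOsc (d := d) S L M Cψ₁ ⟨j, z⟩ l) ≤
      if S j ≤ L * S l ∧ S l ≤ L * S j then B else 0 := by
    intro l
    unfold boxOsc
    by_cases h : S j ≤ L * S l ∧ S l ≤ L * S j
    · rw [if_pos h, if_pos h]
      have hSl : (0 : ℝ) < S l := by exact_mod_cast hS l
      have hcmp : (S j : ℝ) ≤ L * S l := by exact_mod_cast h.1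
      -- |a|·2w²S^d·(d S_l θ) = 2dθ S_l · (|a| w² S^d) ≤ 2dθ S_l · a_max/S_l² = 2 d θ a_max / S_l ≤ 2 d θ a_max L / S_j
      calc |a l| * (2 * (wmax l ^ 2 * ((S l ^ d : ℕ) : ℝ)) * ((d : ℝ) * S l * θ))
          = 2 * d * θ * S l * (|a l| * (wmax l ^ 2 * ((S l ^ d : ℕ) : ℝ))) := by ring
        _ ≤ 2 * d * θ * S l * (amax / (S l : ℝ) ^ 2) := mul_le_mul_of_nonneg_left (hscaleW l) (by positivity)
        _ = 2 * amax * d * θ * (1 / S l) := by field_simp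
        _ ≤ 2 * amax * d * θ * (L / S j) := by
            refine mul_le_mul_of_nonneg_left ?_ (by positivity)
            rw [div_le_div_iff₀ hSl (by linarith), one_mul]
            exact hcmp
        _ = B := by rw [hB]; ring
    · rw [if_neg h, if_neg h]
      simp
  calc ∑ l, |a l| * (2 * (wmax l ^ 2 * ((S l ^ d : ℕ) : ℝ)) * boxOsc (d := d) S L M Cψ₁ ⟨j, z⟩ l)
      ≤ ∑ l, (if S j ≤ L * S l ∧ S l ≤ L * S j then B else 0) := Finset.sum_le_sum fun l _ => hterm l
    _ = ((univ.filter fun l => S j ≤ L * S l ∧ S l ≤ L * S j).card : ℝ) * B := by rw [Finset.sum_ite, Finset.sum_const_zero, add_zero,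
        Finset.sum_const, nsmul_eq_mul]
    _ ≤ (nadj : ℝ) * B := mul_le_mul_of_nonneg_right (by exact_mod_cast hadj j) hB0
    _ = 2 * amax * ((nadj : ℝ) * d * (4 * d + Cψ₁) * L) / ((M : ℝ) * (S j : ℝ) ^ 2) := by
        rw [hB, hθ]
        have hM0 : (0 : ℝ) < M := by exact_mod_cast hM
        field_simp

end Osc

/-! ## §5 THE END: the level-free parametrix for the box family of a layer partition -/

section End

variable (Rm : UT N × Fin d → Cp → Cp → ℝ) (T : J → UT N → Cp → Cp → ℝ) (a : J → ℝ) (ω : J → UT N → ℝ)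
  (c : UT N × Fin d → ℝ)

/-- **THE LEVEL-FREE PARAMETRIX FOR THE BOX FAMILY BUILT FROM A LAYER PARTITION (MODEL; node (w4-a′) reduced to `ψ` + two counts).**
See the module docstring for the input list; conclusion: with `C_rem = remConst d |c₀| a_max C L (4d + C_ψ¹) (d(52 + C_ψ² + 8dC_ψ¹))
(n_adj·d·(4d + C_ψ¹)·L)` and `C_rem·ν/M < 1`, `1 − R′` is a unit, `A⁻¹ = G′₀(1 − R′)⁻¹`, `‖(1 − R′)⁻¹‖_{ℓ²} ≤ (1 − C_remν/M)⁻¹` for the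
remainder `R′` and local part `G′₀` of the box family `boxFam`/`boxHull`. [cite: Balaban1985BackgroundPropagators, (3.87)–(3.90) pp.408–409 + Thm 3.7; Balaban1984PropagatorsII, (2.36)–(2.40) pp.229–230; Balaban1984PropagatorsI, (1.118) p.37] -/
theorem parametrix_boxes [NeZero d]
    (hdisj : ∀ k k' v v', cellPt S hS hdivS lvl zc k v = cellPt S hS hdivS lvl zc k' v' → k = k')
    (hcover : ∀ x : UT N, ∃ k, ∃ v : Box d (S (lvl k)), cellPt S hS hdivS lvl zc k v = x)
    (hRm : ∀ b i j, ∑ k, Rm b k i * Rm b k j = if i = j then (1 : ℝ) else 0)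
    (hT : ∀ l x i i', ∑ k, T l x k i * T l x k i' = if i = i' then (1 : ℝ) else 0) (ha : ∀ j, 0 ≤ a j)
    (hsupp : ∀ l x, ω l (ctrU N (S l) (tblk (hS l) (hdivS l) x)) ≠ 0 → ∃ k v, lvl k = l ∧ cellPt S hS hdivS lvl zc k v = x)
    {wmax : J → ℝ} (hw0 : ∀ l, 0 ≤ wmax l) (hw : ∀ l x, |ω l (ctrU N (S l) (tblk (hS l) (hdivS l) x))| ≤ wmax l)
    {amax : ℝ} (hamax : 0 ≤ amax) (hscaleW : ∀ l, |a l| * (wmax l ^ 2 * ((S l ^ d : ℕ) : ℝ)) ≤ amax / (S l : ℝ) ^ 2)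
    {c₀ : ℝ} (hc : ∀ b, c b = c₀) {C : ℝ} (hC : 0 < C)
    (hcoer : ∀ f : UT N × Cp → ℝ,
      C * ∑ k, ((S (lvl k) : ℝ) ^ 2)⁻¹ * ∑ v : Box d (S (lvl k)), ∑ i, f (cellPt S hS hdivS lvl zc k v, i) ^ 2 ≤
        ∑ p, f p * levelOp bsrc btgt c Rm (fun l x => ctrU N (S l) (tblk (hS l) (hdivS l) x))
          (fun l x => ω l (ctrU N (S l) (tblk (hS l) (hdivS l) x))) T a f p)
    (M : ℕ) (hM : 1 ≤ M) (hMdiv : ∀ j i, M * S j ∣ N i) (h2N : ∀ j i, 2 * (M * S j) ≤ N i) (L : ℕ) (hL : 1 ≤ L)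
    (ψ : J → UT N → ℝ) (hψsq : ∀ x, ∑ j, ψ j x ^ 2 = 1) (hψ1 : ∀ j x, |ψ j x| ≤ 1) {Cψ₁ Cψ₂ : ℝ} (hCψ₁ : 0 ≤ Cψ₁)
    (hCψ₂ : 0 ≤ Cψ₂) (hψd : ∀ j y μ, |ψ j (up y μ) - ψ j y| ≤ Cψ₁ / ((M : ℝ) * S j))
    (hψdd : ∀ j x μ, |ψ j (up x μ) - 2 * ψ j x + ψ j (dn x μ)| ≤ Cψ₂ / ((M : ℝ) * S j) ^ 2)
    (hψcell : ∀ j k, ¬ (S j ≤ L * S (lvl k) ∧ S (lvl k) ≤ L * S j) → ∀ v, ψ j (cellPt S hS hdivS lvl zc k v) = 0) {nadj : ℕ}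
    (hadj : ∀ j, (univ.filter fun l => S j ≤ L * S l ∧ S l ≤ L * S j).card ≤ nadj)
    (hballs : ∀ (j : J) (z : Ctr N (M * S j)), (∃ y, boxFam S M ψ ⟨j, z⟩ y ≠ 0) →
      ∀ k, CellMeets S hS hdivS lvl zc k (ctrU N (M * S j) z) ((M * S j : ℕ) + 1) → S (lvl k) ≤ L * S j)
    {ν : ℝ} (hν0 : 0 ≤ ν) (hν : ∀ x, ∑ p : Σ j : J, Ctr N (M * S j), boxHull S hS hdivS lvl zc hcover M ψ p x ≤ ν)
    (hsmall : remConst d |c₀| amax C L (4 * d + Cψ₁) (d * (52 + Cψ₂ + 8 * d * Cψ₁)) (nadj * d * (4 * d + Cψ₁) * L) / M * ν < 1) :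
    IsUnit (1 - Rsum bsrc btgt c Rm
        (levelSum (fun l x => ctrU N (S l) (tblk (hS l) (hdivS l) x)) (fun l x => ω l (ctrU N (S l) (tblk (hS l) (hdivS l) x))) T a)
        (levelOp bsrc btgt c Rm (fun l x => ctrU N (S l) (tblk (hS l) (hdivS l) x))
          (fun l x => ω l (ctrU N (S l) (tblk (hS l) (hdivS l) x))) T a)
        (boxFam S M ψ) (boxHull S hS hdivS lvl zc hcover M ψ)) ∧
      Ring.inverse (levelOp bsrc btgt c Rm (fun l x => ctrU N (S l) (tblk (hS l) (hdivS l) x))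
          (fun l x => ω l (ctrU N (S l) (tblk (hS l) (hdivS l) x))) T a) =
        G0sum (levelOp bsrc btgt c Rm (fun l x => ctrU N (S l) (tblk (hS l) (hdivS l) x))
          (fun l x => ω l (ctrU N (S l) (tblk (hS l) (hdivS l) x))) T a) (boxFam S M ψ) (boxHull S hS hdivS lvl zc hcover M ψ) *
        Ring.inverse (1 - Rsum bsrc btgt c Rm
          (levelSum (fun l x => ctrU N (S l) (tblk (hS l) (hdivS l) x)) (fun l x => ω l (ctrU N (S l) (tblk (hS l) (hdivS l) x))) T a)
          (levelOp bsrc btgt c Rm (fun l x => ctrU N (S l) (tblk (hS l) (hdivS l) x))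
            (fun l x => ω l (ctrU N (S l) (tblk (hS l) (hdivS l) x))) T a)
          (boxFam S M ψ) (boxHull S hS hdivS lvl zc hcover M ψ)) ∧
      L2Bound (Ring.inverse (1 - Rsum bsrc btgt c Rm
          (levelSum (fun l x => ctrU N (S l) (tblk (hS l) (hdivS l) x)) (fun l x => ω l (ctrU N (S l) (tblk (hS l) (hdivS l) x))) T a)
          (levelOp bsrc btgt c Rm (fun l x => ctrU N (S l) (tblk (hS l) (hdivS l) x))
            (fun l x => ω l (ctrU N (S l) (tblk (hS l) (hdivS l) x))) T a)
          (boxFam S M ψ) (boxHull S hS hdivS lvl zc hcover M ψ)))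
        (1 - remConst d |c₀| amax C L (4 * d + Cψ₁) (d * (52 + Cψ₂ + 8 * d * Cψ₁)) (nadj * d * (4 * d + Cψ₁) * L) / M * ν)⁻¹ := by
  obtain ⟨hχ, hχcell, hsite, hbond, hH⟩ := boxHull_clauses S hS hdivS lvl zc hcover M ψ hdisj hM hballs
  have hMR : (1 : ℝ) ≤ M := by exact_mod_cast hM
  have hLR : (1 : ℝ) ≤ L := by exact_mod_cast hL
  exact parametrix_torus_adapted S hS hdivS lvl zc Rm T a ω c hdisj hcover hRm hT ha hsupp hw0 hw (abs_nonneg c₀) hC hcoer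
    hMR hLR hamax (by positivity) (by positivity) (by positivity) (boxFam S M ψ) (boxFam_sum_sq S hS hM hMdiv h2N ψ hψsq)
    (boxFam_abs_le_one S ψ hψ1) (boxHull S hS hdivS lvl zc hcover M ψ) hχ hχcell hsite hbond
    (fun p => S p.1) (fun p => L * S p.1) (fun p => hS p.1)
    (fun p => Nat.one_le_iff_ne_zero.mpr (Nat.mul_ne_zero (by omega) (by have := hS p.1; omega)))
    (fun p => by push_cast; exact le_rfl) hH
    (fun p b => by obtain ⟨j, z⟩ := p; exact boxFam_cdh_le S hS hM ψ hc hψ1 hψd j z b)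
    (fun p x => by obtain ⟨j, z⟩ := p; exact boxFam_lap_le S hS hM h2N ψ hc hψ1 hψd hψdd j z x)
    (fun p l => boxOsc (d := d) S L M Cψ₁ p l)
    (fun p l => by unfold boxOsc; split_ifs <;> positivity)
    (fun p l x hx => boxFam_osc_le S hS hdivS lvl zc M ψ ω hM hsupp hψ1 hCψ₁ hψd hψcell p l x hx)
    (fun p => boxOsc_sum_le S M hS hM a hamax hscaleW hCψ₁ hL hadj p) hν0 hν hsmall

end End

end

end Summit.QuantumFields.BalabanUV.Beta.MultiscaleParametrixBoxes
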